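import Mathlib
import Summits.NavierStokesRegularity.NavierStokesRegularity.Theorems.TaoLadderRungTwoFlatNearBehindApriori
import HarnessLib

/-!
# The behind BLOCK ENERGIES DURING the hop (not only at landing) and the near-shell amplitude read from them (theory-1 g45
  D13) (helper for the K_A♭ parent item stmt-NavierStokesRegularity-22987 `FlatGapCertificatesV2`, child 2A `GradedAdiabaticWakeA`
  of route TaoLadderRungTwoFlat; cell harvest/h2-tao-ladder, p1 g23; LADDER §54–§57)

Once the clock-weighted bound `clock·|S| ≤ A_eff` holds on every behind bond for the whole hop (output of
`R54.behind_apriori_of_pseudoFlow_sharp` / `R54.near_behind_apriori_of_pseudoFlows`), the transport inequality runs on EVERY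
block and at EVERY intermediate time: `V_L(t) ≤ V₀ + Ē_top·t` for all `L` and `t ∈ [0, τ₁]` — the bottom input of a block is
removed, as at landing (L-55b), by comparing with ever deeper blocks whose bottom input `(1+ε)Λ³·clock(−K−L′)` vanishes. Read on
the near shells `[−D, −K]` (one block, `L = D + 1 − K`), this gives the near zone's a-priori amplitude with the SLOW growth
`e^{θ′(D−K)/2} = (1+ε₀)^{θ_b′(D−K)}` of the (B1) weight instead of the clock factor `(1+ε₀)^{5(D+1)/2}` of
`R54.near_deviation_amp_of_behind` (theory-1 g45, NEAR-BEHIND-57 D13: `ε₀ ≲ 0.29/(θ_b′(D−K))` instead of `≈ 0.009`).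

* `behind_blockEnergy_le_of_apriori` — `V_{[1−K−L,−K]}^{−K+σt}(S)(t) ≤ V₀ + Ē_top·t` for every `L`, `t ∈ [0, τ₁]`;
* `near_amp_of_blockEnergy` — `|S_{im}(t)| ≤ √(2V̄)·e^{θ′/2}·e^{θ′(D−K)/2}` on `m ∈ [−D, −K]` from the block `L = D + 1 − K`;
* `near_deviation_amp_of_blockEnergy` — the near lemma's `hA` input: `|u_{im}(t)| ≤ √(2V̄)e^{θ′/2}e^{θ′(D−K)/2} + M` on `[−D, 1−K]`
  (template `M`, core input `r` at `1 − K`).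

HONEST FRAMING: inequalities about MODEL-lattice certificate flows (graded mirror table on `S♭`, `m = 2`); the a-priori inputs
are HYPOTHESES (or outputs of the cited bootstraps); nothing certified; no item closed; nothing about the Navier–Stokes equations.
-/

noncomputable section

-- the sub-problem namespace repeats the summit name by design (D-0017)
set_option linter.dupNamespace false

namespace Summit.NavierStokesRegularity.NavierStokesRegularity.Theorems.HopTube.R54

open Set Finset Literature.Analysis.FluidPDE Literature.Analysis.FluidPDE.TaoCascade MirrorPulse

section Energy

variable {ε ε₀ τ κ₂ : ℝ} {S₀ F₀ B₀ : Fin 2 → ℤ → ℝ} {S F : Fin 2 → ℤ → ℝ → ℝ}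

/-- **BEHIND BLOCK ENERGIES DURING THE HOP.** Along one exact graded window flow (`0 < ε₀`), the clock-weighted bound
`clock·|S| ≤ A_eff` on every behind bond for all `t ∈ [0, τ₁]`, the weighted top-input bound `Ē_top` on `(0, τ₁)`, the initial
levels `V_L(0) ≤ V₀` (all `L`) and a rate `0 < μ ≤ σθ′ − 2(1+ε)A_eff sinh(θ′/2)` give, for EVERY block and every intermediate time,
`V_{[1−K−L,−K]}^{−K+σt}(S)(t) ≤ V₀ + Ē_top·t` (no bottom input: removed by the deep-block limit; no `1/μ`: `(1−e^{−μt})/μ ≤ t`).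
[cite: Tao2016AveragedNS, §4 (4.1), (4.3), (4.5), (4.8), §6.3–6.4 (statement shape); route TaoLadderRungTwoFlat, R54-1 (B1) during the hop, L-54b/L-55b (cell LADDER §54–§55)] -/
theorem behind_blockEnergy_le_of_apriori
    (hS : PseudoFlowOnShift shiftSetFlat τ ε₀ (mirrorTable ε ε) 0 κ₂ S₀ F₀ B₀ S F)
    (hε : 0 ≤ ε) (hε₀ : 0 < ε₀) {K : ℕ} {θ' σ τ₁ Aeff μ Etop V₀ : ℝ} (hθ : 0 ≤ θ') (hAeff : 0 ≤ Aeff)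
    (hσ : 0 ≤ σ) (hτ₁τ : τ₁ ≤ τ)
    (hbd : ∀ t ∈ Icc 0 τ₁, ∀ n : ℤ, n ≤ -(K : ℤ) →
      clock ε₀ n * |S 1 n t| ≤ Aeff ∧ clock ε₀ n * |S 0 (n + 1) t| ≤ Aeff)
    (hEtop : ∀ t ∈ Ioo 0 τ₁,
      Real.exp (θ' * ((((-(K : ℤ)) : ℤ) : ℝ) - (-(K : ℝ) + σ * t))) * |fluxT ε ε₀ S (-(K : ℤ)) t| ≤ Etop)
    (hEtop0 : 0 ≤ Etop)
    (hV₀ : ∀ L : ℕ, coMovingEnergyOn (Finset.Icc (1 - (K : ℤ) - L) (-(K : ℤ))) θ' (-(K : ℝ)) S 0 ≤ V₀)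
    (hμ : 0 < μ) (hμle : μ ≤ σ * θ' - 2 * (1 + ε) * Aeff * Real.sinh (θ' / 2))
    (L : ℕ) {t : ℝ} (ht : t ∈ Icc 0 τ₁) :
    coMovingEnergyOn (Finset.Icc (1 - (K : ℤ) - L) (-(K : ℤ))) θ' (-(K : ℝ) + σ * t) S t ≤ V₀ + Etop * t := by
  have hε₀' : (-1 : ℝ) ≤ ε₀ := by linarith
  have htτ : t ≤ τ := ht.2.trans hτ₁τ
  have ht0 : 0 ≤ t := ht.1
  -- the flow's qualitative a-priori bound (format clause (4.5))
  obtain ⟨M, hM⟩ := hS.apriori_S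
  have hΛ : ∀ s ∈ Icc 0 τ₁, ∀ (i : Fin 2) (k : ℤ), |S i k s| ≤ max M 0 := by
    intro s hs i k
    have h1 := hM s ⟨hs.1, hs.2.trans hτ₁τ⟩ i k
    have hp : 0 < (1 + ε₀) ^ ((10 : ℝ) * k) := Real.rpow_pos_of_pos (by linarith) _
    have h2 : |S i k s| ≤ (1 + (1 + ε₀) ^ ((10 : ℝ) * k)) * |S i k s| :=
      le_mul_of_one_le_left (abs_nonneg _) (by linarith)
    exact (h2.trans h1).trans (le_max_left _ _)
  set Λ : ℝ := max M 0 with hΛdef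
  have hΛ0 : 0 ≤ Λ := le_max_right _ _
  have hV₀0 : 0 ≤ V₀ := (coMovingEnergyOn_nonneg _ _ _ _ _).trans (hV₀ 0)
  -- `(1 − e^{−μt})/μ ≤ t`
  have hexp : (1 - Real.exp (-μ * t)) / μ ≤ t := by
    rw [div_le_iff₀ hμ]
    have := Real.add_one_le_exp (-μ * t)
    linarith
  have he1 : Real.exp (-μ * t) ≤ 1 := by
    rw [Real.exp_le_one_iff]
    have := mul_nonneg hμ.le ht.1
    linarith
  -- every deeper block `L' ≥ max L 1` at time `t`: transport with its own (small) bottom input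
  have hdeep : ∀ L' : ℕ, 1 ≤ L' → L ≤ L' →
      coMovingEnergyOn (Finset.Icc (1 - (K : ℤ) - L) (-(K : ℤ))) θ' (-(K : ℝ) + σ * t) S t
        ≤ V₀ + Etop * t + (1 + ε) * Λ ^ 3 * clock ε₀ (1 - (K : ℤ) - L' - 1) * t := by
    intro L' hL'1 hLL'
    have hsub : Finset.Icc (1 - (K : ℤ) - L) (-(K : ℤ)) ⊆ Finset.Icc (1 - (K : ℤ) - L') (-(K : ℤ)) := by
      have : (L : ℤ) ≤ L' := by exact_mod_cast hLL'
      exact Finset.Icc_subset_Icc (by omega) le_rfl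
    have haP : (1 - (K : ℤ) - L') ≤ -(K : ℤ) := by
      have : (1 : ℤ) ≤ L' := by exact_mod_cast hL'1
      omega
    have hbd' : ∀ s ∈ Ioo 0 t, ∀ n ∈ Finset.Icc (1 - (K : ℤ) - L' - 1) (-(K : ℤ)),
        clock ε₀ n * |S 1 n s| ≤ Aeff ∧ clock ε₀ n * |S 0 (n + 1) s| ≤ Aeff := fun s hs n hn =>
      hbd s ⟨hs.1.le, hs.2.le.trans ht.2⟩ n (Finset.mem_Icc.mp hn).2
    have hE : ∀ s ∈ Ioo 0 t,
        Real.exp (θ' * ((((1 - (K : ℤ) - L' : ℤ)) : ℝ) - (-(K : ℝ) + σ * s)))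
            * |fluxT ε ε₀ S (1 - (K : ℤ) - L' - 1) s|
          + Real.exp (θ' * ((((-(K : ℤ)) : ℤ) : ℝ) - (-(K : ℝ) + σ * s))) * |fluxT ε ε₀ S (-(K : ℤ)) s|
          ≤ (1 + ε) * Λ ^ 3 * clock ε₀ (1 - (K : ℤ) - L' - 1) + Etop := by
      intro s hs
      have hs' : s ∈ Icc 0 τ₁ := ⟨hs.1.le, hs.2.le.trans ht.2⟩
      have hbot := weighted_bottomFlux_le (θ' := θ') (σ := σ) (K := K) hε hε₀' hθ hL'1 S
        (mul_nonneg hσ hs.1.le) hΛ0 (hΛ s hs' 1 _) (hΛ s hs' 0 _)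
      exact add_le_add hbot (hEtop s ⟨hs.1, hs.2.trans_le ht.2⟩)
    have htr := coMovingEnergyOn_transport_of_pseudoFlow (θ := θ') (σ := σ) (n₀ := -(K : ℝ)) hS hε hε₀' hθ hAeff
      haP le_rfl ht.1 htτ hbd' hE hμ hμle
    rw [sub_zero, mul_zero, add_zero] at htr
    have hf0 : 0 ≤ coMovingEnergyOn (Finset.Icc (1 - (K : ℤ) - L') (-(K : ℤ))) θ' (-(K : ℝ)) S 0 :=
      coMovingEnergyOn_nonneg _ _ _ _ _
    have hc0 : 0 ≤ (1 + ε) * Λ ^ 3 * clock ε₀ (1 - (K : ℤ) - L' - 1) := by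
      have := clock_nonneg hε₀' (1 - (K : ℤ) - L' - 1); positivity
    have hI : ((1 + ε) * Λ ^ 3 * clock ε₀ (1 - (K : ℤ) - L' - 1) + Etop) * (1 - Real.exp (-μ * t)) / μ
        ≤ ((1 + ε) * Λ ^ 3 * clock ε₀ (1 - (K : ℤ) - L' - 1) + Etop) * t := by
      rw [mul_div_assoc]
      exact mul_le_mul_of_nonneg_left hexp (by positivity)
    calc coMovingEnergyOn (Finset.Icc (1 - (K : ℤ) - L) (-(K : ℤ))) θ' (-(K : ℝ) + σ * t) S t
        ≤ coMovingEnergyOn (Finset.Icc (1 - (K : ℤ) - L') (-(K : ℤ))) θ' (-(K : ℝ) + σ * t) S t :=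
          coMovingEnergyOn_mono hsub θ' _ S t
      _ ≤ Real.exp (-μ * t) * coMovingEnergyOn (Finset.Icc (1 - (K : ℤ) - L') (-(K : ℤ))) θ' (-(K : ℝ)) S 0
            + ((1 + ε) * Λ ^ 3 * clock ε₀ (1 - (K : ℤ) - L' - 1) + Etop) * (1 - Real.exp (-μ * t)) / μ := htr
      _ ≤ 1 * V₀ + ((1 + ε) * Λ ^ 3 * clock ε₀ (1 - (K : ℤ) - L' - 1) + Etop) * t :=
          add_le_add (mul_le_mul he1 (hV₀ L') hf0 zero_le_one) hI
      _ = V₀ + Etop * t + (1 + ε) * Λ ^ 3 * clock ε₀ (1 - (K : ℤ) - L' - 1) * t := by ring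
  -- pass to the limit `L' → ∞`
  refine le_of_forall_pos_le_add fun η hη => ?_
  have hD0 : 0 < ((1 + ε) * Λ ^ 3 + 1) * (t + 1) := by positivity
  obtain ⟨L₀, hL₀⟩ := clock_bottom_eventually_le hε₀ K (η / (((1 + ε) * Λ ^ 3 + 1) * (t + 1))) (div_pos hη hD0)
  set L' : ℕ := max (max L 1) L₀ with hL'def
  have h1 := hdeep L' ((le_max_right L 1).trans (le_max_left _ _)) ((le_max_left L 1).trans (le_max_left _ _))
  have h2 := hL₀ L' (le_max_right _ _)
  have h3 : (1 + ε) * Λ ^ 3 * clock ε₀ (1 - (K : ℤ) - L' - 1) * t ≤ η := by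
    have hc0 : 0 ≤ clock ε₀ (1 - (K : ℤ) - L' - 1) := clock_nonneg hε₀' _
    calc (1 + ε) * Λ ^ 3 * clock ε₀ (1 - (K : ℤ) - L' - 1) * t
        ≤ ((1 + ε) * Λ ^ 3 + 1) * (η / (((1 + ε) * Λ ^ 3 + 1) * (t + 1))) * (t + 1) := by
          have ha : (1 + ε) * Λ ^ 3 ≤ (1 + ε) * Λ ^ 3 + 1 := by linarith
          have hb : t ≤ t + 1 := by linarith
          have hq0 : 0 ≤ η / (((1 + ε) * Λ ^ 3 + 1) * (t + 1)) := (div_pos hη hD0).le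
          have hA0 : 0 ≤ (1 + ε) * Λ ^ 3 + 1 := by positivity
          have := mul_le_mul (mul_le_mul ha h2 hc0 hA0) hb ht0 (mul_nonneg hA0 hq0)
          linarith [this]
      _ = η := by
          have hne1 : (1 + ε) * Λ ^ 3 + 1 ≠ 0 := by positivity
          have hne2 : t + 1 ≠ 0 := by linarith
          field_simp
  linarith

/-- **Near-shell amplitude from one behind block energy** (theory-1 g45 D13): with `V_{[−D,−K]}^{−K+σt}(S)(t) ≤ V̄`
(the block `L = D + 1 − K`), `σt ≤ 1`, `0 ≤ θ′`: `|S_{im}(t)| ≤ √(2V̄)·e^{θ′/2}·e^{θ′(D−K)/2}` for every `m ∈ [−D, −K]`.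
[cite: Tao2016AveragedNS, §4 (4.3); route TaoLadderRungTwoFlat, L-54a read on the near block (cell LADDER §54, §57 D13)] -/
theorem near_amp_of_blockEnergy {θ' σ Vbar : ℝ} (hθ : 0 ≤ θ') {K D : ℕ} {S : Fin 2 → ℤ → ℝ → ℝ} {t : ℝ}
    (hσt1 : σ * t ≤ 1)
    (hV : coMovingEnergyOn (Finset.Icc (-(D : ℤ)) (-(K : ℤ))) θ' (-(K : ℝ) + σ * t) S t ≤ Vbar)
    (i : Fin 2) {m : ℤ} (hm : m ∈ Finset.Icc (-(D : ℤ)) (-(K : ℤ))) :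
    |S i m t| ≤ Real.sqrt (2 * Vbar) * Real.exp (θ' / 2) * Real.exp (θ' * ((D : ℝ) - K) / 2) := by
  have h1 := abs_le_of_blockEnergy_le hV i hm
  have hm' := Finset.mem_Icc.mp hm
  have hmR : (-(D : ℝ)) ≤ (m : ℝ) := by exact_mod_cast hm'.1
  have hexp : Real.exp (θ' * ((-(K : ℝ) + σ * t) - m) / 2) ≤ Real.exp (θ' / 2) * Real.exp (θ' * ((D : ℝ) - K) / 2) := by
    rw [← Real.exp_add, Real.exp_le_exp]
    have : θ' * ((-(K : ℝ) + σ * t) - m) ≤ θ' * (1 + ((D : ℝ) - K)) :=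
      mul_le_mul_of_nonneg_left (by linarith) hθ
    linarith
  calc |S i m t| ≤ Real.sqrt (2 * Vbar) * Real.exp (θ' * ((-(K : ℝ) + σ * t) - m) / 2) := h1
    _ ≤ Real.sqrt (2 * Vbar) * (Real.exp (θ' / 2) * Real.exp (θ' * ((D : ℝ) - K) / 2)) :=
        mul_le_mul_of_nonneg_left hexp (Real.sqrt_nonneg _)
    _ = _ := by ring

/-- **The near lemma's a-priori input `hA` from one behind block energy** (theory-1 g45 D13): block energy level `V̄` on
`[−D, −K]`, template `M` on `[−D, 1−K]` and core input `r ≤ A` at `1 − K` give `|u_{im}(t)| ≤ A :=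
√(2V̄)e^{θ′/2}e^{θ′(D−K)/2} + M` on `[−D, 1−K]`. [cite: Tao2016AveragedNS, §4 (4.3); route TaoLadderRungTwoFlat, L8b a-priori input `hA` (cell LADDER §49, §57 D13)] -/
theorem near_deviation_amp_of_blockEnergy {θ' σ Vbar M r : ℝ} (hθ : 0 ≤ θ') {K D : ℕ}
    {S W : Fin 2 → ℤ → ℝ → ℝ} {t : ℝ} (hσt1 : σ * t ≤ 1)
    (hV : coMovingEnergyOn (Finset.Icc (-(D : ℤ)) (-(K : ℤ))) θ' (-(K : ℝ) + σ * t) S t ≤ Vbar)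
    (hM : ∀ i, ∀ m ∈ Finset.Icc (-(D : ℤ)) (1 - (K : ℤ)), |W i m t| ≤ M)
    (hr : ∀ i, |(S - W) i (1 - (K : ℤ)) t| ≤ r)
    (hrA : r ≤ Real.sqrt (2 * Vbar) * Real.exp (θ' / 2) * Real.exp (θ' * ((D : ℝ) - K) / 2) + M)
    (i : Fin 2) {m : ℤ} (hm : m ∈ Finset.Icc (-(D : ℤ)) (1 - (K : ℤ))) :
    |(S - W) i m t| ≤ Real.sqrt (2 * Vbar) * Real.exp (θ' / 2) * Real.exp (θ' * ((D : ℝ) - K) / 2) + M := by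
  have hm' := Finset.mem_Icc.mp hm
  rcases eq_or_lt_of_le hm'.2 with heq | hlt
  · rw [heq]; exact (hr i).trans hrA
  · have hmem : m ∈ Finset.Icc (-(D : ℤ)) (-(K : ℤ)) := Finset.mem_Icc.mpr ⟨hm'.1, by omega⟩
    have hSi := near_amp_of_blockEnergy hθ hσt1 hV i hmem
    have hWi := hM i m hm
    calc |(S - W) i m t| = |S i m t - W i m t| := by simp only [Pi.sub_apply]
      _ ≤ |S i m t| + |W i m t| := abs_sub _ _
      _ ≤ _ := add_le_add hSi hWi

end Energy

end Summit.NavierStokesRegularity.NavierStokesRegularity.Theorems.HopTube.R54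

end
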